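import Literature.AnabelianGeometry.EtaleTheta.Thm56SubdagCodomainsProofs
import Literature.AnabelianGeometry.EtaleTheta.Discharge.Sec5Prop55TransportIndependent
import HarnessLib

/-!
# [EtTh] Prop. 5.5, P55-L06 in the VARYING-CODOMAIN currency: `TransportIndependentCod ν` from the functoriality
# of the native family among codomains (proof-only)

Mochizuki, *The étale theta function and its Frobenioid-theoretic manifestations*, Publ. RIMS **45** (2009)
[EtTh], Prop. 5.5, proof p.328 (PDF p.102) l.1–11 [cite: MochizukiEtTh2009, Prop 5.5 proof p.328 (PDF p.102)]:
«… which is manifestly "functorial" [in the evident sense, with respect to `l·N` codomains of `l·N`-th roots of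
right fraction-pairs of `Θ̈`]. Thus, we may transport this isomorphism from `S″` to an arbitrary
`(l, N)`-theta-saturated `S` by means of linear morphisms `S″ → S`, `S″ → S‴` …, which induce isomorphisms … — hence
also a [functorial] isomorphism …, which is independent of the choice of `S″`, `S‴` and the linear morphisms
`S″ → S`, `S″ → S‴` [precisely because of the original "functoriality" of the isomorphism for `S″`]».

abc-iut cell, layer L2, sub-DAG `plan/L2/SUBDAG-EtTh-Thm56.md`, leaf **P55-L06, varying codomains** — abc-iut-w5-d020's
`Thm56Sub.TransportIndependentCod` (`Thm56SubdagCodomains.lean`, p420185; the binder `hind` of her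
`cyclotomicRigidityCod_of`, p420518), after abc-iut-L2-lead's ruling F-w5d123-3 / F-w5d020-1 (the source of the
transport VARIES over the admissible codomains `IsCod`).  Seat abc-iut-w4-d008 g2 («your `transportIndependent_of`
pattern adapts source-by-source»).  PROOF-ONLY (no definition, no new named fact; laws = hypothesis binders).

WHAT IS PROVED (namespace `ThetaFrobenioid.Thm56Sub`, abstract §5 datum `𝔉 : ThetaFrobenioid C D`):
* `transportIndependentCod_of` — **`TransportIndependentCod 𝔉 ν`** from: (Fc) `hfun` — the native family `ν` is
  FUNCTORIAL along linear morphisms between admissible codomains («manifestly "functorial" … with respect to `l·N`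
  codomains», l.1–2 — the printed reason); (Rc) `href` — COMMON REFINEMENT OVER THE BASE: two linear `φ : S₁ → T`,
  `φ′ : S₂ → T` from codomains to a theta-saturated `T` are dominated by ONE codomain `S₀` through linear `ψ₁ : S₀ → S₁`,
  `ψ₂ : S₀ → S₂` with `Base(ψ₁ ≫ φ) = Base(ψ₂ ≫ φ′)`, `Δ-push(ψᵢ)` onto and `μ-pull(ψ₂)` injective (the Galois property
  of the codomains' base objects, p.331, + «linear morphisms … [which, by the definition of `B_N`, always exist]», l.3–4,
  + «induce isomorphisms», l.5–7); (U) `hUb` — the unit pull-back along a linear morphism depends only on its base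
  morphism ([FrdI] Def. 1.3 (i)(b); theorem at `ofModel`: `ofModel_unitsPull_congr_base`); (Ic) `hinj` — linear
  morphisms out of codomains «induce isomorphisms» on `(l·Δ_Θ) ⊗ ℤ/Nℤ` (injectivity); and the composition laws P55-L06b.
  NO lifting / section hypothesis is needed in this currency: the automorphism bookkeeping of the fixed-source form
  (`transportIndependent_of`: (G)+(S)+(F) at `B_N`) is absorbed by (Rc)+(Fc).
* `cyclotomicRigidityCod_of_laws` — abc-iut-w5-d020's `cyclotomicRigidityCod_of` ([EtTh] Prop. 5.5 in the
  varying-codomain currency) with its binder `hind : TransportIndependentCod ν` DISCHARGED by the above.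
* `lDeltaModNMap_injective_of_reachCod` — (Ic) DERIVED from reachability + (Rc) + Def. 5.4 (b) cardinalities;
  `cyclotomicRigidityCod_of_functorial` — Prop. 5.5 (varying codomains) from `ν`, `hreach`, `hcodSat`, P55-L06b, (U),
  (Fc), (Rc) alone.
* `commonRefinement_of` — (Rc) DECOMPOSED: co-filtered codomains (a) + Galois bases (b) + Aut-ample codomains (c, the
  tree's `IsAutAmple`); `cyclotomicRigidityCod_of_galois` — Prop. 5.5 (varying codomains) from these.
HONEST FRAMING: kernel-checked implications between typed statements about the abstract §5 data; the laws are
hypotheses, not asserted; [EtTh] is refereed; typed ≠ discharged; no side taken on [IUTchIII] Cor. 3.12.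
-/

namespace Literature.AnabelianGeometry.EtaleTheta

open CategoryTheory
open FrobenioidCyclotomicRigidity

universe w v v' u u'

namespace ThetaFrobenioid

namespace Thm56Sub

variable {C : Type u} [Category.{v} C] {D : Type u'} [Category.{v'} D] {𝔉 : ThetaFrobenioid.{w} C D}

/-- **[EtTh] Prop. 5.5, P55-L06 in the varying-codomain currency — `TransportIndependentCod ν` DERIVED** from the
functoriality (Fc) of the native family among codomains (the printed reason «the original "functoriality" of the
isomorphism for `S″`»), common refinement over the base (Rc), the base-dependence of the unit pull-back (U), the
injectivity (Ic) of `Δ-push` along linear morphisms out of codomains, and the laws P55-L06b.  Proof: dominate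
`φ, φ′` by `ψ₁ ≫ φ`, `ψ₂ ≫ φ′ : S₀ → T` with one base map — so with the SAME two transports (`lDeltaModNMap_congr_base`,
(U)); lift `x = Δ-push(ψ₁) x₀`, `x′ = Δ-push(ψ₂) x₀′`; (Ic) gives `x₀ = x₀′`; then `μ-pull(ψ₂)(μ-pull(φ′) u) =
μ-pull(ψ₁ ≫ φ) u = μ-pull(ψ₁)(ν_{S₁} x) = ν_{S₀} x₀ = μ-pull(ψ₂)(ν_{S₂} x′)` by (Fc) twice, and `μ-pull(ψ₂)` is injective.
[cite: MochizukiEtTh2009, Prop 5.5 proof p.328 (PDF p.102)] -/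
theorem transportIndependentCod_of {IsCod : C → Prop} (ν : NativeIsoFamily 𝔉 IsCod)
    (hUc : UnitsPullComp 𝔉) (hLc : LDeltaMapComp 𝔉)
    (hUb : ∀ {S T : C} (φ ψ : S ⟶ T), 𝔉.IsLinear φ → 𝔉.IsLinear ψ → 𝔉.base.map φ = 𝔉.base.map ψ →
      𝔉.unitsPull φ = 𝔉.unitsPull ψ)
    (hfun : ∀ (S₁ S₂ : C) (h₁ : IsCod S₁) (h₂ : IsCod S₂) (ψ : S₁ ⟶ S₂), 𝔉.IsLinear ψ →
      ∀ x : 𝔉.lDeltaModN S₁, 𝔉.muTorsionPull ψ 𝔉.N (ν S₂ h₂ (𝔉.lDeltaModNMap ψ x)) = ν S₁ h₁ x)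
    (href : ∀ (T : C), 𝔉.IsThetaSaturated T → ∀ (S₁ S₂ : C), IsCod S₁ → IsCod S₂ →
      ∀ (φ : S₁ ⟶ T) (φ' : S₂ ⟶ T), 𝔉.IsLinear φ → 𝔉.IsLinear φ' →
        ∃ (S₀ : C) (_ : IsCod S₀) (ψ₁ : S₀ ⟶ S₁) (ψ₂ : S₀ ⟶ S₂), 𝔉.IsLinear ψ₁ ∧ 𝔉.IsLinear ψ₂ ∧
          Function.Surjective (𝔉.lDeltaModNMap ψ₁) ∧ Function.Surjective (𝔉.lDeltaModNMap ψ₂) ∧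
          Function.Injective (𝔉.muTorsionPull ψ₂ 𝔉.N) ∧ 𝔉.base.map (ψ₁ ≫ φ) = 𝔉.base.map (ψ₂ ≫ φ'))
    (hinj : ∀ (T : C), 𝔉.IsThetaSaturated T → ∀ (S₀ : C), IsCod S₀ → ∀ (φ : S₀ ⟶ T), 𝔉.IsLinear φ →
      Function.Injective (𝔉.lDeltaModNMap φ)) :
    TransportIndependentCod 𝔉 ν := by
  intro T hT S₁ S₂ h₁ h₂ φ φ' hφ hφ' x x' u hΔ hμ
  obtain ⟨S₀, h₀, ψ₁, ψ₂, hψ₁, hψ₂, hs₁, hs₂, hi₂, hb⟩ := href T hT S₁ S₂ h₁ h₂ φ φ' hφ hφ'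
  obtain ⟨x₀, rfl⟩ := hs₁ x
  obtain ⟨x₀', rfl⟩ := hs₂ x'
  have hl₁ : 𝔉.IsLinear (ψ₁ ≫ φ) := isLinear_comp hψ₁ hφ
  have hl₂ : 𝔉.IsLinear (ψ₂ ≫ φ') := isLinear_comp hψ₂ hφ'
  -- the `Δ`-side: both composites have one base map, so `x₀ = x₀′` by (Ic)
  have hx : x₀ = x₀' := by
    apply hinj T hT S₀ h₀ (ψ₂ ≫ φ') hl₂
    rw [← lDeltaModNMap_congr_base hb, lDeltaModNMap_comp hLc, hΔ, lDeltaModNMap_comp hLc]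
  -- the `μ`-side: `μ-pull(ψ₂ ≫ φ′) u = μ-pull(ψ₁ ≫ φ) u = ν_{S₀} x₀`
  have hμ' : 𝔉.muTorsionPull (ψ₂ ≫ φ') 𝔉.N u = ν S₀ h₀ x₀ := by
    rw [← muTorsionPull_congr (hUb _ _ hl₁ hl₂ hb), muTorsionPull_comp hUc, hμ, hfun S₀ S₁ h₀ h₁ ψ₁ hψ₁]
  rw [muTorsionPull_comp hUc, hx, ← hfun S₀ S₂ h₀ h₂ ψ₂ hψ₂ x₀'] at hμ'
  exact hi₂ hμ'

/-- **[EtTh] Proposition 5.5 in the varying-codomain currency WITHOUT the independence input** — abc-iut-w5-d020's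
`cyclotomicRigidityCod_of` (`CyclotomicRigidityCod 𝔉 hcodSat ν`: existence ∧ uniqueness of the functorial family
Kummer-determined at every codomain) with `hind : TransportIndependentCod ν` DISCHARGED by `transportIndependentCod_of`;
named inputs: native isos `ν`, reachability `hreach` (abc-iut-w5-d123's shape), `hcodSat`, the laws P55-L06b, and (Fc) `hfun`,
(Rc) `href`, (U) `hUb`, (Ic) `hinj`.  [cite: MochizukiEtTh2009, Prop 5.5 p.327–328 (PDF pp.101–102)] -/
theorem cyclotomicRigidityCod_of_laws {IsCod : C → Prop} (hcodSat : ∀ S'', IsCod S'' → 𝔉.IsThetaSaturated S'')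
    (ν : NativeIsoFamily 𝔉 IsCod)
    (hreach : ∀ S : C, 𝔉.IsThetaSaturated S → ∃ (S'' : C) (_ : IsCod S'') (φ : S'' ⟶ S), 𝔉.IsLinear φ ∧
      Function.Surjective (𝔉.lDeltaModNMap φ) ∧ Function.Injective (𝔉.muTorsionPull φ 𝔉.N))
    (hUc : UnitsPullComp 𝔉) (hUi : UnitsPullId 𝔉) (hLc : LDeltaMapComp 𝔉) (hLi : LDeltaMapId 𝔉)
    (hUb : ∀ {S T : C} (φ ψ : S ⟶ T), 𝔉.IsLinear φ → 𝔉.IsLinear ψ → 𝔉.base.map φ = 𝔉.base.map ψ →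
      𝔉.unitsPull φ = 𝔉.unitsPull ψ)
    (hfun : ∀ (S₁ S₂ : C) (h₁ : IsCod S₁) (h₂ : IsCod S₂) (ψ : S₁ ⟶ S₂), 𝔉.IsLinear ψ →
      ∀ x : 𝔉.lDeltaModN S₁, 𝔉.muTorsionPull ψ 𝔉.N (ν S₂ h₂ (𝔉.lDeltaModNMap ψ x)) = ν S₁ h₁ x)
    (href : ∀ (T : C), 𝔉.IsThetaSaturated T → ∀ (S₁ S₂ : C), IsCod S₁ → IsCod S₂ →
      ∀ (φ : S₁ ⟶ T) (φ' : S₂ ⟶ T), 𝔉.IsLinear φ → 𝔉.IsLinear φ' →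
        ∃ (S₀ : C) (_ : IsCod S₀) (ψ₁ : S₀ ⟶ S₁) (ψ₂ : S₀ ⟶ S₂), 𝔉.IsLinear ψ₁ ∧ 𝔉.IsLinear ψ₂ ∧
          Function.Surjective (𝔉.lDeltaModNMap ψ₁) ∧ Function.Surjective (𝔉.lDeltaModNMap ψ₂) ∧
          Function.Injective (𝔉.muTorsionPull ψ₂ 𝔉.N) ∧ 𝔉.base.map (ψ₁ ≫ φ) = 𝔉.base.map (ψ₂ ≫ φ'))
    (hinj : ∀ (T : C), 𝔉.IsThetaSaturated T → ∀ (S₀ : C), IsCod S₀ → ∀ (φ : S₀ ⟶ T), 𝔉.IsLinear φ →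
      Function.Injective (𝔉.lDeltaModNMap φ)) :
    CyclotomicRigidityCod 𝔉 hcodSat ν :=
  cyclotomicRigidityCod_of hcodSat ν hreach (transportIndependentCod_of ν hUc hLc hUb hfun href hinj) hUc hUi hLc hLi

/-- **Injectivity (Ic) DERIVED** in the varying-codomain currency: from reachability with `Δ-push` ONTO (abc-iut-w5-d123's
`ReachableFromCodomains` shape, `hreach`), common refinement (Rc) and the cardinality clause of Def. 5.4 (b) at both ends
(`IsThetaSaturated.card_lDeltaModN`; codomains are theta-saturated, `hcodSat`), EVERY linear `φ : S₀ → T` from a codomain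
to a theta-saturated `T` has `Δ-push(φ)` onto — it shares its `Δ-push ∘ Δ-push(ψ₁)` with the onto composite
`Δ-push(φ_T) ∘ Δ-push(ψ₂)` — hence bijective («induce isomorphisms», p.328 l.5–7).
[cite: MochizukiEtTh2009, Prop 5.5 proof p.328 (PDF p.102)] -/
theorem lDeltaModNMap_injective_of_reachCod {IsCod : C → Prop}
    (hcodSat : ∀ S'', IsCod S'' → 𝔉.IsThetaSaturated S'') (hLc : LDeltaMapComp 𝔉)
    (hreach : ∀ S : C, 𝔉.IsThetaSaturated S → ∃ (S'' : C) (_ : IsCod S'') (φ : S'' ⟶ S), 𝔉.IsLinear φ ∧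
      Function.Surjective (𝔉.lDeltaModNMap φ) ∧ Function.Injective (𝔉.muTorsionPull φ 𝔉.N))
    (href : ∀ (T : C), 𝔉.IsThetaSaturated T → ∀ (S₁ S₂ : C), IsCod S₁ → IsCod S₂ →
      ∀ (φ : S₁ ⟶ T) (φ' : S₂ ⟶ T), 𝔉.IsLinear φ → 𝔉.IsLinear φ' →
        ∃ (S₀ : C) (_ : IsCod S₀) (ψ₁ : S₀ ⟶ S₁) (ψ₂ : S₀ ⟶ S₂), 𝔉.IsLinear ψ₁ ∧ 𝔉.IsLinear ψ₂ ∧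
          Function.Surjective (𝔉.lDeltaModNMap ψ₁) ∧ Function.Surjective (𝔉.lDeltaModNMap ψ₂) ∧
          Function.Injective (𝔉.muTorsionPull ψ₂ 𝔉.N) ∧ 𝔉.base.map (ψ₁ ≫ φ) = 𝔉.base.map (ψ₂ ≫ φ'))
    (T : C) (hT : 𝔉.IsThetaSaturated T) (S₀ : C) (h₀ : IsCod S₀) (φ : S₀ ⟶ T) (hφ : 𝔉.IsLinear φ) :
    Function.Injective (𝔉.lDeltaModNMap φ) := by
  obtain ⟨S'', h'', φT, hlinT, hsT, -⟩ := hreach T hT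
  obtain ⟨S₁, _, ψ₁, ψ₂, _, _, _, hs₂, -, hb⟩ := href T hT S₀ S'' h₀ h'' φ φT hφ hlinT
  -- `Δ-push(φ)` is onto: `Δ-push(φ) ∘ Δ-push(ψ₁) = Δ-push(φ_T) ∘ Δ-push(ψ₂)` is onto
  have hsurj : Function.Surjective (𝔉.lDeltaModNMap φ) := by
    intro y
    obtain ⟨z, hz⟩ := (hsT.comp hs₂) y
    refine ⟨𝔉.lDeltaModNMap ψ₁ z, ?_⟩
    rw [← lDeltaModNMap_comp hLc, lDeltaModNMap_congr_base hb, lDeltaModNMap_comp hLc]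
    exact hz
  -- equal finite cardinalities `N` (Def. 5.4 (b)) upgrade onto to bijective
  haveI : Finite (𝔉.lDeltaModN S₀) :=
    Nat.finite_of_card_ne_zero (by rw [(hcodSat S₀ h₀).card_lDeltaModN]; exact 𝔉.N.ne_zero)
  exact (hsurj.bijective_of_nat_card_le (by rw [(hcodSat S₀ h₀).card_lDeltaModN, hT.card_lDeltaModN])).1

/-- **[EtTh] Proposition 5.5, varying-codomain currency, from functoriality + refinement alone**:
`cyclotomicRigidityCod_of_laws` with (Ic) DISCHARGED by `lDeltaModNMap_injective_of_reachCod` — named inputs: native isos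
`ν`, reachability `hreach`, `hcodSat`, the laws P55-L06b, (U) `hUb`, (Fc) `hfun`, (Rc) `href`.
[cite: MochizukiEtTh2009, Prop 5.5 p.327–328 (PDF pp.101–102)] -/
theorem cyclotomicRigidityCod_of_functorial {IsCod : C → Prop} (hcodSat : ∀ S'', IsCod S'' → 𝔉.IsThetaSaturated S'')
    (ν : NativeIsoFamily 𝔉 IsCod)
    (hreach : ∀ S : C, 𝔉.IsThetaSaturated S → ∃ (S'' : C) (_ : IsCod S'') (φ : S'' ⟶ S), 𝔉.IsLinear φ ∧
      Function.Surjective (𝔉.lDeltaModNMap φ) ∧ Function.Injective (𝔉.muTorsionPull φ 𝔉.N))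
    (hUc : UnitsPullComp 𝔉) (hUi : UnitsPullId 𝔉) (hLc : LDeltaMapComp 𝔉) (hLi : LDeltaMapId 𝔉)
    (hUb : ∀ {S T : C} (φ ψ : S ⟶ T), 𝔉.IsLinear φ → 𝔉.IsLinear ψ → 𝔉.base.map φ = 𝔉.base.map ψ →
      𝔉.unitsPull φ = 𝔉.unitsPull ψ)
    (hfun : ∀ (S₁ S₂ : C) (h₁ : IsCod S₁) (h₂ : IsCod S₂) (ψ : S₁ ⟶ S₂), 𝔉.IsLinear ψ →
      ∀ x : 𝔉.lDeltaModN S₁, 𝔉.muTorsionPull ψ 𝔉.N (ν S₂ h₂ (𝔉.lDeltaModNMap ψ x)) = ν S₁ h₁ x)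
    (href : ∀ (T : C), 𝔉.IsThetaSaturated T → ∀ (S₁ S₂ : C), IsCod S₁ → IsCod S₂ →
      ∀ (φ : S₁ ⟶ T) (φ' : S₂ ⟶ T), 𝔉.IsLinear φ → 𝔉.IsLinear φ' →
        ∃ (S₀ : C) (_ : IsCod S₀) (ψ₁ : S₀ ⟶ S₁) (ψ₂ : S₀ ⟶ S₂), 𝔉.IsLinear ψ₁ ∧ 𝔉.IsLinear ψ₂ ∧
          Function.Surjective (𝔉.lDeltaModNMap ψ₁) ∧ Function.Surjective (𝔉.lDeltaModNMap ψ₂) ∧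
          Function.Injective (𝔉.muTorsionPull ψ₂ 𝔉.N) ∧ 𝔉.base.map (ψ₁ ≫ φ) = 𝔉.base.map (ψ₂ ≫ φ')) :
    CyclotomicRigidityCod 𝔉 hcodSat ν :=
  cyclotomicRigidityCod_of_laws hcodSat ν hreach hUc hUi hLc hLi hUb hfun href
    (lDeltaModNMap_injective_of_reachCod hcodSat hLc hreach href)

/-- `Δ-push` along an automorphism is onto (composition and identity laws P55-L06b).
[cite: MochizukiEtTh2009, Prop 5.5 proof p.328 (PDF p.102)] -/
theorem lDeltaModNMap_aut_surjective (hLc : LDeltaMapComp 𝔉) (hLi : LDeltaMapId 𝔉) {S : C} (β : S ≅ S) :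
    Function.Surjective (𝔉.lDeltaModNMap β.hom) := fun y =>
  ⟨𝔉.lDeltaModNMap β.inv y, by rw [← lDeltaModNMap_comp hLc, Iso.inv_hom_id, lDeltaModNMap_id hLi]⟩

/-- **The common-refinement law (Rc) DECOMPOSED into its printed constituents**: (a) `hcof` — the admissible codomains
are co-filtered by linear morphisms with `Δ-push` onto and `μ-pull` injective (the tower of `l·N`-codomains `S″` of
roots, «linear morphisms `S″ → S` … [which, by the definition of `B_N`, always exist]», p.328 l.3–4, with «induce
isomorphisms», l.5–7); (b) `hgalCod` — the base object of a codomain is GALOIS: the base maps of two linear morphisms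
`S₀ → T` differ by an element of `Aut_D(S₀^bs)` (p.331 (PDF p.105)); (c) `hample` — codomains are Aut-ample (the tree's
`IsAutAmple`; p.330 (PDF p.104) «it follows that `B_N` is Aut-ample»).  Then two codomain arrows `φ : S₁ → T`,
`φ′ : S₂ → T` are dominated by `α ≫ ψ₁` and `ψ₂` from one codomain `S₀` with EQUAL composite base maps, `α` the
Aut-ample lift of the Galois discrepancy.  [cite: MochizukiEtTh2009, Prop 5.5 proof p.328 (PDF p.102)] -/
theorem commonRefinement_of {IsCod : C → Prop} (hLc : LDeltaMapComp 𝔉) (hLi : LDeltaMapId 𝔉)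
    (hcof : ∀ (S₁ S₂ : C), IsCod S₁ → IsCod S₂ →
      ∃ (S₀ : C) (_ : IsCod S₀) (ψ₁ : S₀ ⟶ S₁) (ψ₂ : S₀ ⟶ S₂), 𝔉.IsLinear ψ₁ ∧ 𝔉.IsLinear ψ₂ ∧
        Function.Surjective (𝔉.lDeltaModNMap ψ₁) ∧ Function.Surjective (𝔉.lDeltaModNMap ψ₂) ∧
        Function.Injective (𝔉.muTorsionPull ψ₂ 𝔉.N))
    (hgalCod : ∀ (T : C), 𝔉.IsThetaSaturated T → ∀ (S₀ : C), IsCod S₀ → ∀ (f f' : S₀ ⟶ T),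
      𝔉.IsLinear f → 𝔉.IsLinear f' → ∃ g : Aut (𝔉.base.obj S₀), 𝔉.base.map f' = g.hom ≫ 𝔉.base.map f)
    (hample : ∀ (S₀ : C), IsCod S₀ → 𝔉.IsAutAmple S₀)
    (T : C) (hT : 𝔉.IsThetaSaturated T) (S₁ S₂ : C) (h₁ : IsCod S₁) (h₂ : IsCod S₂) (φ : S₁ ⟶ T)
    (φ' : S₂ ⟶ T) (hφ : 𝔉.IsLinear φ) (hφ' : 𝔉.IsLinear φ') :
    ∃ (S₀ : C) (_ : IsCod S₀) (ψ₁ : S₀ ⟶ S₁) (ψ₂ : S₀ ⟶ S₂), 𝔉.IsLinear ψ₁ ∧ 𝔉.IsLinear ψ₂ ∧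
      Function.Surjective (𝔉.lDeltaModNMap ψ₁) ∧ Function.Surjective (𝔉.lDeltaModNMap ψ₂) ∧
      Function.Injective (𝔉.muTorsionPull ψ₂ 𝔉.N) ∧ 𝔉.base.map (ψ₁ ≫ φ) = 𝔉.base.map (ψ₂ ≫ φ') := by
  obtain ⟨S₀, h₀, ψ₁, ψ₂, hψ₁, hψ₂, hs₁, hs₂, hi₂⟩ := hcof S₁ S₂ h₁ h₂
  -- the Galois discrepancy of the two composite base maps, lifted to an automorphism of `S₀`
  obtain ⟨g, hg⟩ := hgalCod T hT S₀ h₀ (ψ₁ ≫ φ) (ψ₂ ≫ φ') (isLinear_comp hψ₁ hφ) (isLinear_comp hψ₂ hφ')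
  obtain ⟨α, hα⟩ := hample S₀ h₀ g
  have hαb : 𝔉.base.map α.hom = g.hom := congrArg Iso.hom hα
  refine ⟨S₀, h₀, α.hom ≫ ψ₁, ψ₂, isLinear_comp (𝔉.isLinear_of_aut α) hψ₁, hψ₂, ?_, hs₂, hi₂, ?_⟩
  · intro y
    obtain ⟨z, rfl⟩ := hs₁ y
    obtain ⟨w, rfl⟩ := lDeltaModNMap_aut_surjective hLc hLi α z
    exact ⟨w, lDeltaModNMap_comp hLc _ _ w⟩
  · rw [Category.assoc, CategoryTheory.Functor.map_comp, hαb, hg]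

/-- **[EtTh] Proposition 5.5, varying-codomain currency, from the printed structural properties**: native isos `ν`
functorial among codomains (Fc), reachability `hreach`, co-filtered codomains (a) `hcof`, Galois bases (b) `hgalCod`,
Aut-ample codomains (c) `hample`, theta-saturated codomains `hcodSat`, the unit law (U) and the laws P55-L06b —
`cyclotomicRigidityCod_of_functorial` with (Rc) supplied by `commonRefinement_of`.
[cite: MochizukiEtTh2009, Prop 5.5 p.327–328 (PDF pp.101–102)] -/
theorem cyclotomicRigidityCod_of_galois {IsCod : C → Prop} (hcodSat : ∀ S'', IsCod S'' → 𝔉.IsThetaSaturated S'')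
    (ν : NativeIsoFamily 𝔉 IsCod)
    (hreach : ∀ S : C, 𝔉.IsThetaSaturated S → ∃ (S'' : C) (_ : IsCod S'') (φ : S'' ⟶ S), 𝔉.IsLinear φ ∧
      Function.Surjective (𝔉.lDeltaModNMap φ) ∧ Function.Injective (𝔉.muTorsionPull φ 𝔉.N))
    (hUc : UnitsPullComp 𝔉) (hUi : UnitsPullId 𝔉) (hLc : LDeltaMapComp 𝔉) (hLi : LDeltaMapId 𝔉)
    (hUb : ∀ {S T : C} (φ ψ : S ⟶ T), 𝔉.IsLinear φ → 𝔉.IsLinear ψ → 𝔉.base.map φ = 𝔉.base.map ψ →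
      𝔉.unitsPull φ = 𝔉.unitsPull ψ)
    (hfun : ∀ (S₁ S₂ : C) (h₁ : IsCod S₁) (h₂ : IsCod S₂) (ψ : S₁ ⟶ S₂), 𝔉.IsLinear ψ →
      ∀ x : 𝔉.lDeltaModN S₁, 𝔉.muTorsionPull ψ 𝔉.N (ν S₂ h₂ (𝔉.lDeltaModNMap ψ x)) = ν S₁ h₁ x)
    (hcof : ∀ (S₁ S₂ : C), IsCod S₁ → IsCod S₂ →
      ∃ (S₀ : C) (_ : IsCod S₀) (ψ₁ : S₀ ⟶ S₁) (ψ₂ : S₀ ⟶ S₂), 𝔉.IsLinear ψ₁ ∧ 𝔉.IsLinear ψ₂ ∧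
        Function.Surjective (𝔉.lDeltaModNMap ψ₁) ∧ Function.Surjective (𝔉.lDeltaModNMap ψ₂) ∧
        Function.Injective (𝔉.muTorsionPull ψ₂ 𝔉.N))
    (hgalCod : ∀ (T : C), 𝔉.IsThetaSaturated T → ∀ (S₀ : C), IsCod S₀ → ∀ (f f' : S₀ ⟶ T),
      𝔉.IsLinear f → 𝔉.IsLinear f' → ∃ g : Aut (𝔉.base.obj S₀), 𝔉.base.map f' = g.hom ≫ 𝔉.base.map f)
    (hample : ∀ (S₀ : C), IsCod S₀ → 𝔉.IsAutAmple S₀) :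
    CyclotomicRigidityCod 𝔉 hcodSat ν :=
  cyclotomicRigidityCod_of_functorial hcodSat ν hreach hUc hUi hLc hLi hUb hfun
    (commonRefinement_of hLc hLi hcof hgalCod hample)

end Thm56Sub

end ThetaFrobenioid

end Literature.AnabelianGeometry.EtaleTheta
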